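import Literature.NumberTheory.LFunctions.DivisorSumCharConvMajorant
import Literature.NumberTheory.LFunctions.DivisorSumCharSqSmoothedMoment
import HarnessLib

/-!
# The explicit formula for the smoothed logarithmic second moment of the majorant `ν ∗ ν`, with
# the remainder on the critical line

Topic `Literature/NumberTheory/LFunctions`. Everything here is PROVED (no definitions, no named facts).

Let `χ ≠ 1` be a Dirichlet character mod `D ≥ 1`, `ν = 1 ∗ χ` (the tree's `divisorSumChar χ`),
`b = ν ∗ ν` (Mathlib's `ν ⍟ ν`, `Σ b(n) n^{-w} = ζ(w)² L(w,χ)²`), `d` the divisor function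
(`ZetaM4.dCoeff`) and `W_f(X) = Σ_{n≥1} f(n) n^{-1} e^{-n/X}` (`DivisorSumCharSq.W`). For `0 < A`,
`0 < B` we prove (`explicit_formula_conv`, stub T2 of SKELETON I6c-typed, line
`majorant-critical-line`, cell landau-siegel/ls-inputs):

  `W_b(B) − W_b(A) = L(1,χ)² (W_d(B) − W_d(A)) + (log B − log A) · 2 L(1,χ) L′(1,χ)
      + (1/2π) ∫ ζ(1+z)² Γ(z) (B^z − A^z) (L(1+z,χ)² − L(1,χ)²) dy`,   `z = −1/2 + iy`.

This is the tree's Mellin/contour skeleton `DivisorSumCharSq.explicit_formula` (there for `ν²` with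
`g(z) = L(1+z,χ)² φ(1+z)` and the line `re z = −1/4`) run VERBATIM for the majorant coefficients
`b`, whose `g(z) = L(1+z,χ)²` is ENTIRE: the numerator
`N(z) = ζ₁(1+z)² Γ(z+1) ε(z) · (g(z) − g(0))/z` is holomorphic on `re z > −1`, so the line of
integration can be taken ON the critical line `re(1+z) = ½` (no `ζ(2w)^{-1}`, no
`∏_{p∣D}(1+p^{-w})^{-1}`). Mellin on `re z = 2` (`integral_Gamma_cpow_LSeries_eq`), the split
`ζ(1+z)² g(z) = g(0) ζ(1+z)² + ζ(1+z)²(g(z) − g(0))` leaving a simple pole at `z = 0` with residue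
`(log B − log A) g′(0) = (log B − log A) · 2L(1,χ)L′(1,χ)`, and the strip residue theorem
`HuxleyZeroDetection.integral_vertical_sub_eq_of_pole` on `−1/2 ≤ re z ≤ 2`.

## References
* [ConreyIwaniec2002] B. Conrey, H. Iwaniec, Acta Arith. 103 (2002) 259–312, §6 (6.43)–(6.48).
* [Zhang2022LandauSiegel] Y. Zhang, arXiv:2211.02515, §3, proof of Lemma 3.1 (the Mellin skeleton).
-/

noncomputable section

open Complex Filter Topology Set MeasureTheory Real
open scoped LSeries.notation

namespace Literature.NumberTheory.LFunctions.DivisorSumCharSq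

open Literature.NumberTheory.LFunctions.ZetaM4 (dCoeff dCoeff_apply norm_dCoeff_le_one_mul
  LSeries_dCoeff CΓ CΓ_pos norm_Gamma_strip_le integrable_pow_mul_exp exists_pow_mul_exp_le)
open Literature.NumberTheory.LFunctions.HuxleyZeroDetection (smoothed integral_vertical_sub_eq_of_pole)
open Literature.NumberTheory.LFunctions.Zhang2022.Lemma57 (LSeries_divisorSumChar)

variable {D : ℕ} [NeZero D] (χ : DirichletCharacter ℂ D)

/-! ### The Dirichlet series of `b = ν ⍟ ν` and the entire function `g(z) = L(1+z,χ)²` -/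

omit [NeZero D] in
/-- `ν = 1 ∗ χ` has an absolutely convergent Dirichlet series on `re s > 1`.
[cite: ConreyIwaniec2002, §6 (6.43)] -/
theorem LSeriesSummable_divisorSumChar {s : ℂ} (hs : 1 < s.re) :
    LSeriesSummable (fun n => divisorSumChar χ n) s := by
  have hfun : (fun n => divisorSumChar χ n) = ((fun n : ℕ => χ (n : ZMod D)) ⍟ (1 : ℕ → ℂ)) := by
    funext n
    rw [LSeries.convolution_def, divisorSumChar_apply]
    simp only [Pi.one_apply, mul_one]
    exact (Nat.sum_divisorsAntidiagonal (fun i _ => χ (i : ZMod D)) (n := n)).symm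
  rw [hfun]
  exact (DirichletCharacter.LSeriesSummable_of_one_lt_re χ hs).convolution
    (LSeriesSummable_one_iff.mpr hs)

/-- `Σ (ν ⍟ ν)(n) n^{-s} = ζ(s)² L(s,χ)²` for `re s > 1` — the `φ`-free part of
Conrey–Iwaniec's `R_K(s)` (6.43). [cite: ConreyIwaniec2002, §6 (6.43)] -/
theorem LSeries_conv {s : ℂ} (hs : 1 < s.re) :
    L (divisorSumChar χ ⍟ divisorSumChar χ) s = riemannZeta s ^ 2 * χ.LFunction s ^ 2 := by
  rw [LSeries_convolution' (LSeriesSummable_divisorSumChar χ hs)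
    (LSeriesSummable_divisorSumChar χ hs), LSeries_divisorSumChar χ hs]
  ring

/-- `Σ (ν ⍟ ν)(n) n^{-(1+z)} = ζ(1+z)² g(z)`, `g(z) = L(1+z,χ)²`, for `re z > 0`.
[cite: ConreyIwaniec2002, §6 (6.43)] -/
theorem LSeries_conv_one_add {z : ℂ} (hz : 0 < z.re) :
    L (divisorSumChar χ ⍟ divisorSumChar χ) (1 + z) =
      riemannZeta (1 + z) ^ 2 * (fun w : ℂ => χ.LFunction (1 + w) ^ 2) z :=
  LSeries_conv χ (by simp; linarith)

/-- `g(z) = L(1+z,χ)²` is entire for `χ ≠ 1`. [cite: ConreyIwaniec2002, §6 (6.43)] -/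
theorem differentiable_gConv (hχ1 : χ ≠ 1) :
    Differentiable ℂ (fun w : ℂ => χ.LFunction (1 + w) ^ 2) :=
  ((DirichletCharacter.differentiable_LFunction hχ1).comp
    ((differentiable_const (1 : ℂ)).add differentiable_id)).pow 2

/-- `g′(0) = 2 L(1,χ) L′(1,χ)` — the residue datum replacing Conrey–Iwaniec's `β` (6.45) for the
majorant. [cite: ConreyIwaniec2002, §6 (6.44)–(6.45)] -/
theorem deriv_gConv_zero (hχ1 : χ ≠ 1) :
    deriv (fun w : ℂ => χ.LFunction (1 + w) ^ 2) 0 = 2 * χ.LFunction 1 * deriv χ.LFunction 1 := by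
  have hL : HasDerivAt χ.LFunction (deriv χ.LFunction 1) ((1 : ℂ) + 0) := by
    rw [add_zero]
    exact ((DirichletCharacter.differentiable_LFunction hχ1) 1).hasDerivAt
  have h1 : HasDerivAt (fun w : ℂ => χ.LFunction (1 + w)) (deriv χ.LFunction 1) 0 :=
    hL.comp_const_add 1 0
  have h2 : HasDerivAt (fun w : ℂ => χ.LFunction (1 + w) ^ 2)
      (((2 : ℕ) : ℂ) * χ.LFunction (1 + 0) ^ (2 - 1) * deriv χ.LFunction 1) 0 := h1.pow 2
  rw [h2.deriv]
  simp

/-! ### The numerator `N(z) = ζ₁(1+z)² Γ(z+1) ε(z) (g(z) − g(0))/z` -/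

/-- `N(0) = (log B − log A) · 2 L(1,χ) L′(1,χ)`. [cite: ConreyIwaniec2002, §6 (6.48)] -/
theorem numerConv_zero (hχ1 : χ ≠ 1) {A B : ℝ} (hA : 0 < A) (hB : 0 < B) :
    riemannZeta₁ (1 + 0) ^ 2 * Complex.Gamma (0 + 1) * eps A B 0 *
        dslope (fun w : ℂ => χ.LFunction (1 + w) ^ 2) 0 0 =
      (Real.log B - Real.log A) * (2 * χ.LFunction 1 * deriv χ.LFunction 1) := by
  rw [add_zero, riemannZeta₁_one, zero_add, Complex.Gamma_one, eps_zero hA hB, dslope_same,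
    deriv_gConv_zero χ hχ1]
  ring

/-- Off `z = 0` (and off the poles of `Γ`),
`N(z)/z = ζ(1+z)² Γ(z) (B^z − A^z)(L(1+z,χ)² − L(1,χ)²)`. [cite: ConreyIwaniec2002, §6 (6.48)] -/
theorem numerConv_div_eq {A B : ℝ} {z : ℂ} (hz : z ≠ 0) (hz' : ∀ m : ℕ, z ≠ -(m : ℂ)) :
    (fun z : ℂ => riemannZeta₁ (1 + z) ^ 2 * Complex.Gamma (z + 1) * eps A B z *
        dslope (fun w : ℂ => χ.LFunction (1 + w) ^ 2) 0 z) z / z =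
      riemannZeta (1 + z) ^ 2 * Complex.Gamma z *
        (((B : ℂ) ^ z - (A : ℂ) ^ z) * (χ.LFunction (1 + z) ^ 2 - χ.LFunction 1 ^ 2)) := by
  have h1 : (1 : ℂ) + z ≠ 1 := by intro h; exact hz (by linear_combination h)
  simp only
  rw [LFunctions.riemannZeta₁_eq_mul h1, Complex.Gamma_add_one _ hz, eps_of_ne_zero _ _ hz,
    dslope_of_ne _ hz, slope_def_field, sub_zero, add_sub_cancel_left, add_zero]
  have := hz' 0
  field_simp

/-- `N` is differentiable on the open half-plane `re z > −1`. [cite: ConreyIwaniec2002, §6 (6.48)] -/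
theorem differentiableOn_numerConv (hχ1 : χ ≠ 1) {A B : ℝ} (hA : 0 < A) (hB : 0 < B) :
    DifferentiableOn ℂ (fun z : ℂ => riemannZeta₁ (1 + z) ^ 2 * Complex.Gamma (z + 1) * eps A B z *
        dslope (fun w : ℂ => χ.LFunction (1 + w) ^ 2) 0 z) {z : ℂ | -1 < z.re} := by
  have hU : {z : ℂ | -1 < z.re} ∈ 𝓝 (0 : ℂ) :=
    (isOpen_lt continuous_const Complex.continuous_re).mem_nhds (by simp)
  have hq : DifferentiableOn ℂ (dslope (fun w : ℂ => χ.LFunction (1 + w) ^ 2) 0)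
      {z : ℂ | -1 < z.re} :=
    (Complex.differentiableOn_dslope hU).2 (differentiable_gConv χ hχ1).differentiableOn
  intro z hz
  have hz' : -1 < z.re := hz
  refine DifferentiableWithinAt.mul ?_ (hq z hz)
  refine DifferentiableAt.differentiableWithinAt ?_
  refine DifferentiableAt.mul (DifferentiableAt.mul ?_ ?_) ((differentiable_eps hA hB) z)
  · exact ((differentiable_riemannZeta₁.comp
      ((differentiable_const (1 : ℂ)).add differentiable_id)) z).pow 2
  · refine (Complex.differentiableAt_Gamma _ fun m hm => ?_).comp z (differentiableAt_id.add_const 1)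
    have := congrArg Complex.re hm
    simp at this
    have h0 : (0 : ℝ) ≤ m := Nat.cast_nonneg m
    linarith

/-! ### The line `re z = 2`: Mellin -/

/-- The integrand on `re z = 2`: for `z = 2 + iy`,
`N(z)/z = Γ(z) B^z L(b,1+z) − Γ(z) A^z L(b,1+z) − g(0)(Γ(z) B^z L(d,1+z) − Γ(z) A^z L(d,1+z))`.
[cite: ConreyIwaniec2002, §6 (6.47)–(6.48)] -/
theorem numerConv_div_line_two {A B : ℝ} (y : ℝ) :
    (fun z : ℂ => riemannZeta₁ (1 + z) ^ 2 * Complex.Gamma (z + 1) * eps A B z *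
        dslope (fun w : ℂ => χ.LFunction (1 + w) ^ 2) 0 z) (2 + y * I) / (2 + y * I - 0) =
      (Complex.Gamma (2 + y * I) * (B : ℂ) ^ (2 + y * I : ℂ) *
          L (divisorSumChar χ ⍟ divisorSumChar χ) (1 + (2 + y * I)) -
        Complex.Gamma (2 + y * I) * (A : ℂ) ^ (2 + y * I : ℂ) *
          L (divisorSumChar χ ⍟ divisorSumChar χ) (1 + (2 + y * I))) -
      χ.LFunction 1 ^ 2 * (Complex.Gamma (2 + y * I) * (B : ℂ) ^ (2 + y * I : ℂ) *
          L dCoeff (1 + (2 + y * I)) -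
        Complex.Gamma (2 + y * I) * (A : ℂ) ^ (2 + y * I : ℂ) * L dCoeff (1 + (2 + y * I))) := by
  have hz : (2 + y * I : ℂ) ≠ 0 := by
    intro h; have := congrArg Complex.re h; simp at this
  have hz' : ∀ m : ℕ, (2 + y * I : ℂ) ≠ -(m : ℂ) := by
    intro m h
    have := congrArg Complex.re h
    simp only [add_re, re_ofNat, mul_re, ofReal_re, I_re, mul_zero, ofReal_im, I_im, mul_one,
      sub_self, add_zero, neg_re, natCast_re] at this
    linarith [(Nat.cast_nonneg m : (0:ℝ) ≤ m)]
  have hre : 0 < (2 + y * I : ℂ).re := by simp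
  have h3 : 1 < (1 + (2 + y * I) : ℂ).re := by norm_num
  rw [sub_zero, numerConv_div_eq χ hz hz', LSeries_conv_one_add χ hre, LSeries_dCoeff h3]
  ring

/-- **The line `re z = 2`**: `∫ N(2+iy)/(2+iy) dy
= 2π [ (W_b(B) − W_b(A)) − L(1,χ)² (W_d(B) − W_d(A)) ]`, and the integrand is integrable.
[cite: ConreyIwaniec2002, §6 (6.47)–(6.48)] -/
theorem integral_numerConv_line_two {A B : ℝ} (hA : 0 < A) (hB : 0 < B) :
    Integrable (fun y : ℝ => (fun z : ℂ => riemannZeta₁ (1 + z) ^ 2 * Complex.Gamma (z + 1) *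
        eps A B z * dslope (fun w : ℂ => χ.LFunction (1 + w) ^ 2) 0 z) (2 + y * I) /
          (2 + y * I - 0)) ∧
    ∫ y : ℝ, (fun z : ℂ => riemannZeta₁ (1 + z) ^ 2 * Complex.Gamma (z + 1) *
        eps A B z * dslope (fun w : ℂ => χ.LFunction (1 + w) ^ 2) 0 z) (2 + y * I) /
          (2 + y * I - 0) =
      2 * π * ((W (divisorSumChar χ ⍟ divisorSumChar χ) B - W (divisorSumChar χ ⍟ divisorSumChar χ) A) -
        χ.LFunction 1 ^ 2 * (W dCoeff B - W dCoeff A)) := by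
  obtain ⟨C, -, hC⟩ := exists_norm_conv_le χ
  have hd : ∀ n, ‖dCoeff n‖ ≤ 1 * n := norm_dCoeff_le_one_mul
  have I₁ := integrable_Gamma_cpow_LSeries hC hB
  have I₂ := integrable_Gamma_cpow_LSeries hC hA
  have I₃ := integrable_Gamma_cpow_LSeries hd hB
  have I₄ := integrable_Gamma_cpow_LSeries hd hA
  have hfun : (fun y : ℝ => (fun z : ℂ => riemannZeta₁ (1 + z) ^ 2 * Complex.Gamma (z + 1) *
        eps A B z * dslope (fun w : ℂ => χ.LFunction (1 + w) ^ 2) 0 z) (2 + y * I) /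
          (2 + y * I - 0)) = fun y : ℝ =>
      (Complex.Gamma (2 + y * I) * (B : ℂ) ^ (2 + y * I : ℂ) *
          L (divisorSumChar χ ⍟ divisorSumChar χ) (1 + (2 + y * I)) -
        Complex.Gamma (2 + y * I) * (A : ℂ) ^ (2 + y * I : ℂ) *
          L (divisorSumChar χ ⍟ divisorSumChar χ) (1 + (2 + y * I))) -
      χ.LFunction 1 ^ 2 * (Complex.Gamma (2 + y * I) * (B : ℂ) ^ (2 + y * I : ℂ) *
          L dCoeff (1 + (2 + y * I)) -
        Complex.Gamma (2 + y * I) * (A : ℂ) ^ (2 + y * I : ℂ) * L dCoeff (1 + (2 + y * I))) :=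
    funext fun y => numerConv_div_line_two χ y
  rw [hfun]
  have I12 : Integrable fun y : ℝ =>
      Complex.Gamma (2 + y * I) * (B : ℂ) ^ (2 + y * I : ℂ) *
          L (divisorSumChar χ ⍟ divisorSumChar χ) (1 + (2 + y * I)) -
        Complex.Gamma (2 + y * I) * (A : ℂ) ^ (2 + y * I : ℂ) *
          L (divisorSumChar χ ⍟ divisorSumChar χ) (1 + (2 + y * I)) := I₁.sub I₂
  have I34 : Integrable fun y : ℝ =>
      Complex.Gamma (2 + y * I) * (B : ℂ) ^ (2 + y * I : ℂ) * L dCoeff (1 + (2 + y * I)) -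
        Complex.Gamma (2 + y * I) * (A : ℂ) ^ (2 + y * I : ℂ) * L dCoeff (1 + (2 + y * I)) :=
    I₃.sub I₄
  have I34' : Integrable fun y : ℝ => χ.LFunction 1 ^ 2 *
      (Complex.Gamma (2 + y * I) * (B : ℂ) ^ (2 + y * I : ℂ) * L dCoeff (1 + (2 + y * I)) -
        Complex.Gamma (2 + y * I) * (A : ℂ) ^ (2 + y * I : ℂ) * L dCoeff (1 + (2 + y * I))) :=
    I34.const_mul _
  refine ⟨I12.sub I34', ?_⟩
  rw [integral_sub I12 I34', integral_sub I₁ I₂, integral_const_mul, integral_sub I₃ I₄,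
    integral_Gamma_cpow_LSeries_eq hC hB, integral_Gamma_cpow_LSeries_eq hC hA,
    integral_Gamma_cpow_LSeries_eq hd hB, integral_Gamma_cpow_LSeries_eq hd hA]
  ring

/-! ### Bounds in the closed strip `−1/2 ≤ re z ≤ 2` -/

/-- For `χ ≠ 1` and `re z ≥ −1/2`: `‖L(1+z, χ)‖ ≤ D ‖1+z‖ Σ_{n≥1} n^{-3/2}` (Abel summation, the
tree's `DirichletAbel.norm_LFunction_le`). [cite: ConreyIwaniec2002, §6 (6.48)] -/
theorem norm_LFunction_one_add_le_half (hχ1 : χ ≠ 1) {z : ℂ} (h1 : -(1 / 2) ≤ z.re) :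
    ‖χ.LFunction (1 + z)‖ ≤ D * ‖1 + z‖ * ∑' n : ℕ, ((n + 1 : ℕ) : ℝ) ^ (-(1 / 2 : ℝ) - 1) := by
  have hs : 0 < (1 + z : ℂ).re := by simp; linarith
  refine (DirichletAbel.norm_LFunction_le χ hχ1 hs).trans ?_
  have hZ : ∑' n : ℕ, ((n + 1 : ℕ) : ℝ) ^ (-(1 + z : ℂ).re - 1) ≤
      ∑' n : ℕ, ((n + 1 : ℕ) : ℝ) ^ (-(1 / 2 : ℝ) - 1) := by
    refine Summable.tsum_le_tsum (fun n => ?_) (DirichletAbel.summable_rpow_neg hs)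
      (DirichletAbel.summable_rpow_neg (by norm_num))
    refine Real.rpow_le_rpow_of_exponent_le (by exact_mod_cast Nat.le_add_left 1 n) ?_
    simp only [add_re, one_re] at *
    linarith
  have h0 : 0 ≤ (D : ℝ) * ‖1 + z‖ := by positivity
  exact mul_le_mul_of_nonneg_left hZ h0

omit [NeZero D] χ in
/-- `X^x ≤ X^{-1/2} + X²` for `X > 0`, `−1/2 ≤ x ≤ 2`. [cite: ConreyIwaniec2002, §6 (6.48)] -/
private theorem rpow_le_rpow_add_half {X x : ℝ} (hX : 0 < X) (h1 : -(1 / 2) ≤ x) (h2 : x ≤ 2) :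
    X ^ x ≤ X ^ (-(1 / 2) : ℝ) + X ^ (2 : ℝ) := by
  rcases le_or_gt 1 X with hX1 | hX1
  · have := Real.rpow_le_rpow_of_exponent_le hX1 h2
    linarith [Real.rpow_nonneg hX.le (-(1 / 2) : ℝ)]
  · have := Real.rpow_le_rpow_of_exponent_ge hX hX1.le h1
    linarith [Real.rpow_nonneg hX.le (2 : ℝ)]

omit [NeZero D] χ in
/-- **`ε` in the wide strip**, away from `0`: `‖ε(z)‖ ≤ 4 (B^{-1/2} + B² + A^{-1/2} + A²)` for
`−1/2 ≤ re z ≤ 2`, `‖z‖ ≥ 1/4`. [cite: ConreyIwaniec2002, §6 (6.48)] -/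
private theorem norm_eps_le_half {A B : ℝ} (hA : 0 < A) (hB : 0 < B) {z : ℂ}
    (h1 : -(1 / 2) ≤ z.re) (h2 : z.re ≤ 2) (hz : 1 / 4 ≤ ‖z‖) :
    ‖eps A B z‖ ≤ 4 * (B ^ (-(1 / 2) : ℝ) + B ^ (2 : ℝ) + (A ^ (-(1 / 2) : ℝ) + A ^ (2 : ℝ))) := by
  have hz0 : z ≠ 0 := by
    intro h; rw [h, norm_zero] at hz; norm_num at hz
  rw [eps_of_ne_zero _ _ hz0, norm_div]
  set M : ℝ := B ^ (-(1 / 2) : ℝ) + B ^ (2 : ℝ) + (A ^ (-(1 / 2) : ℝ) + A ^ (2 : ℝ)) with hM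
  have hnum : ‖(B : ℂ) ^ z - (A : ℂ) ^ z‖ ≤ M := by
    refine (norm_sub_le _ _).trans ?_
    rw [Complex.norm_cpow_eq_rpow_re_of_pos hB, Complex.norm_cpow_eq_rpow_re_of_pos hA, hM]
    exact add_le_add (rpow_le_rpow_add_half hB h1 h2) (rpow_le_rpow_add_half hA h1 h2)
  have hM0 : 0 ≤ M := by rw [hM]; positivity
  rw [div_le_iff₀ (by linarith)]
  nlinarith

/-- **The numerator in the wide strip**: for `χ ≠ 1` there is `K ≥ 0` (depending on `χ, A, B`)
with `‖N(z)‖ ≤ K (1 + |im z|)¹³ e^{-π|im z|/2}` for `−1/2 ≤ re z ≤ 2`, `‖z‖ ≥ 1/4`.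
[cite: ConreyIwaniec2002, §6 (6.48)] -/
theorem norm_numerConv_le (hχ1 : χ ≠ 1) {A B : ℝ} (hA : 0 < A) (hB : 0 < B) :
    ∃ K : ℝ, 0 ≤ K ∧ ∀ z : ℂ, -(1 / 2) ≤ z.re → z.re ≤ 2 → 1 / 4 ≤ ‖z‖ →
      ‖(fun z : ℂ => riemannZeta₁ (1 + z) ^ 2 * Complex.Gamma (z + 1) * eps A B z *
          dslope (fun w : ℂ => χ.LFunction (1 + w) ^ 2) 0 z) z‖ ≤
        K * ((1 + |z.im|) ^ 13 * Real.exp (-(π * |z.im| / 2))) := by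
  set Z : ℝ := ∑' n : ℕ, ((n + 1 : ℕ) : ℝ) ^ (-(1 / 2 : ℝ) - 1) with hZ
  have hZ0 : 0 ≤ Z := tsum_nonneg fun n => by positivity
  set M : ℝ := B ^ (-(1 / 2) : ℝ) + B ^ (2 : ℝ) + (A ^ (-(1 / 2) : ℝ) + A ^ (2 : ℝ)) with hM
  have hM0 : 0 ≤ M := by rw [hM]; positivity
  have hC := CΓ_pos
  refine ⟨5 ^ 8 * CΓ * (4 * M) * (72 * ((D : ℝ) * Z) ^ 2), by positivity,
    fun z h1 h2 hz => ?_⟩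
  have hy0 := abs_nonneg z.im
  have hzn : ‖z‖ ≤ 2 + |z.im| := by
    have := Complex.norm_le_abs_re_add_abs_im z
    have : |z.re| ≤ 2 := abs_le.2 ⟨by linarith, h2⟩
    linarith
  have h1z : ‖(1 : ℂ) + z‖ ≤ 3 * (1 + |z.im|) := by
    have := norm_add_le (1 : ℂ) z
    rw [norm_one] at this
    linarith
  -- ζ₁
  have hζ : ‖riemannZeta₁ (1 + z)‖ ≤ 5 ^ 4 * (1 + |z.im|) ^ 4 := by
    have h := BurnolVectors.norm_riemannZeta₁_le (s := 1 + z) (by simp; linarith)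
    refine h.trans ?_
    have : ‖(1 : ℂ) + z‖ + 2 ≤ 5 * (1 + |z.im|) := by linarith
    calc (‖(1 : ℂ) + z‖ + 2) ^ 4 ≤ (5 * (1 + |z.im|)) ^ 4 := by gcongr
      _ = 5 ^ 4 * (1 + |z.im|) ^ 4 := by ring
  -- Γ
  have hΓ : ‖Complex.Gamma (z + 1)‖ ≤ CΓ * (1 + |z.im|) ^ 3 * Real.exp (-(π * |z.im| / 2)) := by
    have := norm_Gamma_strip_le (x := z.re + 1) (by linarith) (by linarith) z.im
    have e : ((z.re + 1 : ℝ) : ℂ) + z.im * I = z + 1 := by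
      rw [show ((z.re + 1 : ℝ) : ℂ) = (z.re : ℂ) + 1 by push_cast; ring]
      conv_rhs => rw [← Complex.re_add_im z]
      ring
    rwa [e] at this
  -- ε
  have hε := norm_eps_le_half hA hB h1 h2 hz
  rw [← hM] at hε
  -- dslope g 0
  have hz0 : z ≠ 0 := by
    intro h; rw [h, norm_zero] at hz; norm_num at hz
  have hg : ‖χ.LFunction (1 + z) ^ 2‖ ≤ ((D : ℝ) * Z) ^ 2 * (9 * (1 + |z.im|) ^ 2) := by
    rw [norm_pow]
    have hL := norm_LFunction_one_add_le_half χ hχ1 h1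
    rw [← hZ] at hL
    calc ‖χ.LFunction (1 + z)‖ ^ 2 ≤ ((D : ℝ) * ‖(1 : ℂ) + z‖ * Z) ^ 2 :=
          pow_le_pow_left₀ (norm_nonneg _) hL 2
      _ ≤ ((D : ℝ) * (3 * (1 + |z.im|)) * Z) ^ 2 := by gcongr
      _ = _ := by ring
  have hg0 : ‖χ.LFunction (1 + 0) ^ 2‖ ≤ ((D : ℝ) * Z) ^ 2 * (9 * (1 + |z.im|) ^ 2) := by
    rw [norm_pow]
    have hL := norm_LFunction_one_add_le_half χ hχ1 (z := 0) (by simp)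
    rw [← hZ, add_zero, norm_one, mul_one] at hL
    rw [add_zero]
    have h19 : (1 : ℝ) ≤ 9 * (1 + |z.im|) ^ 2 := by nlinarith
    calc ‖χ.LFunction 1‖ ^ 2 ≤ ((D : ℝ) * Z) ^ 2 := pow_le_pow_left₀ (norm_nonneg _) hL 2
      _ = ((D : ℝ) * Z) ^ 2 * 1 := by ring
      _ ≤ _ := by gcongr
  have hq : ‖dslope (fun w : ℂ => χ.LFunction (1 + w) ^ 2) 0 z‖ ≤
      72 * ((D : ℝ) * Z) ^ 2 * (1 + |z.im|) ^ 2 := by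
    rw [dslope_of_ne _ hz0, slope_def_field, sub_zero, norm_div, div_le_iff₀ (by linarith)]
    have := norm_sub_le (χ.LFunction (1 + z) ^ 2) (χ.LFunction (1 + 0) ^ 2)
    nlinarith [norm_nonneg (χ.LFunction (1 + z) ^ 2 - χ.LFunction (1 + 0) ^ 2)]
  -- combine
  have hE := Real.exp_pos (-(π * |z.im| / 2))
  simp only
  rw [norm_mul, norm_mul, norm_mul, norm_pow]
  calc ‖riemannZeta₁ (1 + z)‖ ^ 2 * ‖Complex.Gamma (z + 1)‖ * ‖eps A B z‖ *
        ‖dslope (fun w : ℂ => χ.LFunction (1 + w) ^ 2) 0 z‖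
      ≤ (5 ^ 4 * (1 + |z.im|) ^ 4) ^ 2 * (CΓ * (1 + |z.im|) ^ 3 * Real.exp (-(π * |z.im| / 2))) *
          (4 * M) * (72 * ((D : ℝ) * Z) ^ 2 * (1 + |z.im|) ^ 2) := by
        gcongr
    _ = 5 ^ 8 * CΓ * (4 * M) * (72 * ((D : ℝ) * Z) ^ 2) *
          ((1 + |z.im|) ^ 13 * Real.exp (-(π * |z.im| / 2))) := by ring

/-! ### The lines `re z = 2`, `re z = −1/2` and the horizontal decay -/

/-- `y ↦ N(c+iy)/(c+iy)` is continuous for `c > −1`, `c ≠ 0`. [cite: ConreyIwaniec2002, §6 (6.48)] -/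
theorem continuous_numerConv_div_line (hχ1 : χ ≠ 1) {A B : ℝ} (hA : 0 < A) (hB : 0 < B) {c : ℝ}
    (hc : -1 < c) (hc0 : c ≠ 0) :
    Continuous fun y : ℝ => (fun z : ℂ => riemannZeta₁ (1 + z) ^ 2 * Complex.Gamma (z + 1) *
        eps A B z * dslope (fun w : ℂ => χ.LFunction (1 + w) ^ 2) 0 z) (c + y * I) /
          ((c : ℂ) + y * I - 0) := by
  have hd := differentiableOn_numerConv χ hχ1 hA hB
  have hline : Continuous fun y : ℝ => (c : ℂ) + y * I := by fun_prop
  refine (hd.continuousOn.comp_continuous hline fun y => by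
    simp only [mem_setOf_eq, add_re, ofReal_re, mul_re, I_re, mul_zero, ofReal_im, I_im, mul_one,
      sub_self, add_zero]; exact hc).div
    (hline.congr fun y => by rw [sub_zero]) fun y h => hc0 ?_
  have := congrArg Complex.re h; simpa using this

/-- Integrability of `N(c+iy)/(c+iy)` on the lines `c = −1/2` and `c = 2`.
[cite: ConreyIwaniec2002, §6 (6.48)] -/
theorem integrable_numerConv_div_line (hχ1 : χ ≠ 1) {A B : ℝ} (hA : 0 < A) (hB : 0 < B) {c : ℝ}
    (hc : c = -(1 / 2) ∨ c = 2) :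
    Integrable fun y : ℝ => (fun z : ℂ => riemannZeta₁ (1 + z) ^ 2 * Complex.Gamma (z + 1) *
        eps A B z * dslope (fun w : ℂ => χ.LFunction (1 + w) ^ 2) 0 z) (c + y * I) /
          ((c : ℂ) + y * I - 0) := by
  have hc1 : -(1 / 2) ≤ c := by rcases hc with h | h <;> norm_num [h]
  have hc2 : c ≤ 2 := by rcases hc with h | h <;> norm_num [h]
  have hca : 1 / 4 ≤ |c| := by
    rcases hc with h | h <;> (rw [h]; norm_num [abs_of_neg, abs_of_pos])
  have hc0 : c ≠ 0 := by intro h; rw [h] at hca; norm_num at hca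
  obtain ⟨K, hK0, hK⟩ := norm_numerConv_le χ hχ1 hA hB
  have hcont := continuous_numerConv_div_line χ hχ1 hA hB (c := c) (by linarith) hc0
  refine (((integrable_pow_mul_exp 13).const_mul (K * 4)).mono' hcont.aestronglyMeasurable
    (Eventually.of_forall fun y => ?_))
  rw [sub_zero, norm_div]
  have hw : 1 / 4 ≤ ‖((c : ℂ) + y * I)‖ := by
    have hre : (((c : ℂ) + y * I)).re = c := by simp
    have := abs_re_le_norm (((c : ℂ) + y * I))
    rw [hre] at this
    exact hca.trans this
  have him : (((c : ℂ) + y * I)).im = y := by simp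
  have hb := hK ((c : ℂ) + y * I) (by simpa using hc1) (by simpa using hc2) hw
  rw [him] at hb
  rw [div_le_iff₀ (by linarith)]
  calc ‖(fun z : ℂ => riemannZeta₁ (1 + z) ^ 2 * Complex.Gamma (z + 1) *
        eps A B z * dslope (fun w : ℂ => χ.LFunction (1 + w) ^ 2) 0 z) ((c : ℂ) + y * I)‖
      ≤ K * ((1 + |y|) ^ 13 * Real.exp (-(π * |y| / 2))) := hb
    _ = K * 4 * ((1 + |y|) ^ 13 * Real.exp (-(π * |y| / 2))) * (1 / 4) := by ring
    _ ≤ K * 4 * ((1 + |y|) ^ 13 * Real.exp (-(π * |y| / 2))) * ‖((c : ℂ) + y * I)‖ := by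
        gcongr

/-- Horizontal decay of `N(z)/z` in the strip `−1/2 ≤ re z ≤ 2`. [cite: ConreyIwaniec2002, §6 (6.48)] -/
theorem numerConv_horizontal_decay (hχ1 : χ ≠ 1) {A B : ℝ} (hA : 0 < A) (hB : 0 < B) (ε : ℝ)
    (hε : 0 < ε) :
    ∃ T₀ : ℝ, ∀ σ ∈ Icc (-(1 / 2) : ℝ) 2, ∀ T : ℝ, T₀ ≤ |T| →
      ‖(fun z : ℂ => riemannZeta₁ (1 + z) ^ 2 * Complex.Gamma (z + 1) *
        eps A B z * dslope (fun w : ℂ => χ.LFunction (1 + w) ^ 2) 0 z) (σ + T * I) /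
          (σ + T * I - 0)‖ ≤ ε := by
  obtain ⟨K, hK0, hK⟩ := norm_numerConv_le χ hχ1 hA hB
  obtain ⟨T₁, hT₁⟩ := exists_pow_mul_exp_le 13 hK0 hε
  refine ⟨max T₁ 1, fun σ hσ T hT => ?_⟩
  have hTT : T₁ ≤ |T| := le_trans (le_max_left _ _) hT
  have hT1 : 1 ≤ |T| := le_trans (le_max_right _ _) hT
  set w : ℂ := (σ : ℂ) + T * I with hw
  have hwim : w.im = T := by simp [hw]
  have hwre : w.re = σ := by simp [hw]
  have hwn : 1 ≤ ‖w‖ := by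
    have := abs_im_le_norm w; rw [hwim] at this; linarith
  have hb := hK w (by rw [hwre]; exact hσ.1) (by rw [hwre]; exact hσ.2) (by linarith)
  rw [hwim] at hb
  rw [sub_zero, norm_div]
  calc ‖(fun z : ℂ => riemannZeta₁ (1 + z) ^ 2 * Complex.Gamma (z + 1) *
        eps A B z * dslope (fun w : ℂ => χ.LFunction (1 + w) ^ 2) 0 z) w‖ / ‖w‖
      ≤ ‖(fun z : ℂ => riemannZeta₁ (1 + z) ^ 2 * Complex.Gamma (z + 1) *
        eps A B z * dslope (fun w : ℂ => χ.LFunction (1 + w) ^ 2) 0 z) w‖ :=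
        div_le_self (norm_nonneg _) hwn
    _ ≤ K * ((1 + |T|) ^ 13 * Real.exp (-(π * |T| / 2))) := hb
    _ ≤ ε := hT₁ T hTT

/-- **The shift from `re z = 2` to the critical line `re z = −1/2`** across the simple pole of
`N(z)/z` at `z = 0` (the tree's `HuxleyZeroDetection.integral_vertical_sub_eq_of_pole`):
`∫ N(2+iy)/(2+iy) dy − ∫ N(−½+iy)/(−½+iy) dy = 2π N(0) = 2π (log B − log A) · 2L(1,χ)L′(1,χ)`.
[cite: ConreyIwaniec2002, §6 (6.48)] -/
theorem integral_numerConv_shift (hχ1 : χ ≠ 1) {A B : ℝ} (hA : 0 < A) (hB : 0 < B) :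
    (∫ y : ℝ, (fun z : ℂ => riemannZeta₁ (1 + z) ^ 2 * Complex.Gamma (z + 1) *
        eps A B z * dslope (fun w : ℂ => χ.LFunction (1 + w) ^ 2) 0 z) (2 + y * I) /
          (2 + y * I - 0)) -
      (∫ y : ℝ, (fun z : ℂ => riemannZeta₁ (1 + z) ^ 2 * Complex.Gamma (z + 1) *
        eps A B z * dslope (fun w : ℂ => χ.LFunction (1 + w) ^ 2) 0 z)
          ((-(1 / 2) : ℝ) + y * I) / ((((-(1 / 2) : ℝ)) : ℂ) + y * I - 0)) =
      2 * π * ((Real.log B - Real.log A) * (2 * χ.LFunction 1 * deriv χ.LFunction 1)) := by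
  have hshift := integral_vertical_sub_eq_of_pole
    (fun z : ℂ => riemannZeta₁ (1 + z) ^ 2 * Complex.Gamma (z + 1) *
        eps A B z * dslope (fun w : ℂ => χ.LFunction (1 + w) ^ 2) 0 z) 0 (a := -(1 / 2)) (b := 2)
    (by simp) (by simp) ((differentiableOn_numerConv χ hχ1 hA hB).mono fun w hw => by
      simp only [mem_setOf_eq]; have := hw.1.1; linarith)
    (integrable_numerConv_div_line χ hχ1 hA hB (Or.inl rfl))
    (by simpa using integrable_numerConv_div_line χ hχ1 hA hB (c := 2) (Or.inr rfl))
    (numerConv_horizontal_decay χ hχ1 hA hB)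
  rw [numerConv_zero χ hχ1 hA hB] at hshift
  simpa using hshift

/-- **Explicit formula for the smoothed logarithmic second moment of the majorant `ν ∗ ν`**
(numerator form): for `χ ≠ 1`, `0 < A`, `0 < B`,
`W_b(B) − W_b(A) = L(1,χ)²(W_d(B) − W_d(A)) + (log B − log A)·2L(1,χ)L′(1,χ)
  + (1/2π) ∫ N(−½+iy)/(−½+iy) dy`. [cite: ConreyIwaniec2002, §6 (6.47)–(6.48)] -/
theorem explicit_formula_conv_numer (hχ1 : χ ≠ 1) {A B : ℝ} (hA : 0 < A) (hB : 0 < B) :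
    W (divisorSumChar χ ⍟ divisorSumChar χ) B - W (divisorSumChar χ ⍟ divisorSumChar χ) A =
      χ.LFunction 1 ^ 2 * (W dCoeff B - W dCoeff A) +
      (Real.log B - Real.log A) * (2 * χ.LFunction 1 * deriv χ.LFunction 1) +
      (1 / (2 * π)) * ∫ y : ℝ, (fun z : ℂ => riemannZeta₁ (1 + z) ^ 2 * Complex.Gamma (z + 1) *
        eps A B z * dslope (fun w : ℂ => χ.LFunction (1 + w) ^ 2) 0 z)
          ((-(1 / 2) : ℝ) + y * I) / ((((-(1 / 2) : ℝ)) : ℂ) + y * I - 0) := by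
  have hshift := integral_numerConv_shift χ hχ1 hA hB
  obtain ⟨-, h2⟩ := integral_numerConv_line_two χ hA hB
  rw [h2] at hshift
  have hπ : (π : ℂ) ≠ 0 := ofReal_ne_zero.2 Real.pi_pos.ne'
  field_simp
  linear_combination hshift

/-- **EXPLICIT FORMULA FOR THE MAJORANT ON THE CRITICAL LINE** (stub T2 of SKELETON I6c-typed): for
`χ ≠ 1` mod `D ≥ 1`, `0 < A`, `0 < B`,
`W_{ν∗ν}(B) − W_{ν∗ν}(A) = L(1,χ)²(W_d(B) − W_d(A)) + (log B − log A)·2L(1,χ)L′(1,χ)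
+ (1/2π) ∫ ζ(1+z)² Γ(z) (B^z − A^z)(L(1+z,χ)² − L(1,χ)²) dy`, `z = −1/2 + iy` — Conrey–Iwaniec's
(6.47)–(6.48) for the majorant with the Mellin kernel `Γ(z)(B^z − A^z)` and the remainder ON the
line `re(1+z) = ½`. [cite: ConreyIwaniec2002, §6 (6.47)–(6.48)] -/
theorem explicit_formula_conv (hχ1 : χ ≠ 1) {A B : ℝ} (hA : 0 < A) (hB : 0 < B) :
    W (divisorSumChar χ ⍟ divisorSumChar χ) B - W (divisorSumChar χ ⍟ divisorSumChar χ) A =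
      χ.LFunction 1 ^ 2 * (W dCoeff B - W dCoeff A) +
      (Real.log B - Real.log A) * (2 * χ.LFunction 1 * deriv χ.LFunction 1) +
      (1 / (2 * (Real.pi : ℂ))) * ∫ y : ℝ,
        riemannZeta (1 + ((-(1 / 2 : ℝ) : ℂ) + y * I)) ^ 2 *
          Complex.Gamma ((-(1 / 2 : ℝ) : ℂ) + y * I) *
          ((B : ℂ) ^ ((-(1 / 2 : ℝ) : ℂ) + y * I) - (A : ℂ) ^ ((-(1 / 2 : ℝ) : ℂ) + y * I)) *
          (χ.LFunction (1 + ((-(1 / 2 : ℝ) : ℂ) + y * I)) ^ 2 - χ.LFunction 1 ^ 2) := by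
  rw [explicit_formula_conv_numer χ hχ1 hA hB]
  congr 2
  refine integral_congr_ae (Eventually.of_forall fun y => ?_)
  have hz : ((((-(1 / 2) : ℝ)) : ℂ) + y * I) ≠ 0 := by
    intro h; have := congrArg Complex.re h; simp at this
  have hz' : ∀ m : ℕ, ((((-(1 / 2) : ℝ)) : ℂ) + y * I) ≠ -(m : ℂ) := by
    intro m h
    have := congrArg Complex.im h
    simp only [add_im, ofReal_im, mul_im, ofReal_re, I_im, mul_one, I_re, mul_zero, add_zero,
      zero_add, neg_im, natCast_im, neg_zero] at this
    subst this
    have := congrArg Complex.re h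
    simp only [add_re, ofReal_re, mul_re, I_re, mul_zero, ofReal_im, I_im, mul_one, sub_self,
      add_zero, neg_re, natCast_re] at this
    have h2 : (2 : ℝ) * m = 1 := by linarith
    have h3 : (2 * m : ℕ) = 1 := by exact_mod_cast h2
    omega
  simp only
  rw [sub_zero, numerConv_div_eq χ hz hz']
  push_cast
  ring

end Literature.NumberTheory.LFunctions.DivisorSumCharSq

end
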